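import Literature.NumberTheory.Automorphic.ArchRankOneLimitFormula
import Literature.NumberTheory.Automorphic.ArchRankOneOrbitChart        -- ★ p840627 (HB) F0P3a-p07: `exists_integral_comp_conj_diag_eq_smul_integral_chart` (ED. 2)
import Literature.NumberTheory.Automorphic.ArchDiagonalTorus
import Literature.NumberTheory.Automorphic.UnitaryGroupFormTransport
import HarnessLib

/-!
# Harish-Chandra's limit formula ON THE GROUP `U(e₀,e₁)` (`e₀e₁ < 0`): `lim_{ψ→0, ψ≠0} ∂_ψ [2 sin ψ · ∫_{G₂} f(h·diag(z e^{iψ}, z e^{−iψ})·h⁻¹) dμ₂] = C·f(z·1)`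
Topic `NumberTheory/Automorphic`; ns `Literature.NumberTheory.Automorphic.UnitaryGroup`; THEOREMS ONLY.  Cell `pub/hodgecm-mathlib`, ENGINE T1 (crux H413 = `stmt-HodgeConjecture-24833`);
FLOOR-2 brick (R1G) under rows #88∕#111, letter (J-nc) `ArchLimitFormulaNoncompactWall` (★ p840202); socket of F0P3a-p06's (γ) descent `archLimitFormulaNoncompactWall_holds`
(LEAD F0P3a-plan (g9) T8-35 (D)∕T8-36; author B-p17 (g24), 2026-09-01; ED. 2 = §4).  §1 core: on any subgroup `S ≤ GL₂(ℂ)` containing the circle torus, the ORBIT-CHART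
IDENTITY `∫_S f(h·diag(a,b)·h⁻¹) dμ = C₁ • ∫_{s>1,θ} f(b•1 + (a−b)•P(s,θ))` (hypothesis) + ★ `ArchRankOneLimitFormula` (M4) give differentiability on `0 < |ψ| < 1` and
`∂_ψ[2 sin ψ · ∫_S f(h·γ_ψ·h⁻¹) dμ] → (−2π·C₁) • f(z•1)`; §2 transport along a torus-fixing conjugation `S′ ≃ₜ* S` (Haar pushed forward, `f ↦ f(T⁻¹·T)`); §3 weights:
`U(σ, diag(σ a))` is congruent to `U(±diag(1,−1)) = U(diag(1,−1))` by `T = diag(√|e₀|, √|e₁|)` (★ `unitaryGroupOfFormCongrOfEq`) ⇒ (R1G) modulo (HB); §4 (ED. 2): (HB) := ★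
`ArchRankOneOrbitChart` (F0P3a-p07, p840627) ⇒ the hypothesis-free **`exists_tendsto_deriv_two_sin_smul_orbitalIntegral`**.  HONEST LABEL: HC_CM is proved only modulo the
printed citations until rung 0 closes.  Refs: [Varadarajan1989] §6.4 Thm 22; [Rogawski1990] §8.2 Prop. 8.2.1 p. 119, §3.8 p. 30; [PlatonovRapinchuk1994] §2.3.
-/

set_option autoImplicit false

namespace Literature.NumberTheory.Automorphic.UnitaryGroup

open _root_.MeasureTheory Set Filter _root_.Topology _root_.Complex
open scoped Real Matrix.Norms.Operator MatrixGroups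

variable {E : Type*} [NormedAddCommGroup E] [NormedSpace ℝ E] [CompleteSpace E]

/-! ## §1 From the orbit-chart identity to the limit formula on a subgroup of `GL₂(ℂ)` containing the circle torus -/

/-- **Core step (standard chart).**  Let `S ≤ GL₂(ℂ)` contain the circle torus, `μ` a measure on `S`, and suppose the ORBIT-CHART
IDENTITY with constant `C₁`: for every continuous compactly supported `f` and `a ≠ b` on the circle,
`∫_S f(h·diag(a,b)·h⁻¹) dμ = C₁ • ∫_{s>1, θ∈(0,2π]} f(b•1 + (a−b)•P(s,θ))` (F0P3a-p07's `ArchRankOneOrbitChart` for `S = U(1,1)` and Haar `μ`).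
Then for `f ∈ C¹_c` and `z ∈ S¹` the Weyl-normalised orbital integral `ψ ↦ 2 sin ψ · ∫_S f(h·diag(z e^{iψ}, z e^{−iψ})·h⁻¹) dμ` is
differentiable for `0 < |ψ| < 1` and its derivative tends to `(−2π·C₁) • f(z•1)` as `ψ → 0`, `ψ ≠ 0` (★ `tendsto_deriv_two_sin_smul_integral_chart`).
[cite: Varadarajan1989, §6.4 Thm 22; Rogawski1990, §8.2 p. 119] -/
theorem tendsto_deriv_two_sin_smul_integral_conj_of_chart_identity (S : Subgroup (GL (Fin 2) ℂ))
    [MeasurableSpace S] (μ : Measure S) (hS : ∀ w : Fin 2 → Circle, circleDiagonal 2 w ∈ S) (C₁ : ℝ)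
    (hμ : ∀ (f : Matrix (Fin 2) (Fin 2) ℂ → E), Continuous f → HasCompactSupport f → ∀ a b : Circle, a ≠ b →
      ∫ h : S, f (((h : GL (Fin 2) ℂ) : Matrix (Fin 2) (Fin 2) ℂ) * Matrix.diagonal ![(a : ℂ), (b : ℂ)] *
          (((h⁻¹ : S) : GL (Fin 2) ℂ) : Matrix (Fin 2) (Fin 2) ℂ)) ∂μ =
        C₁ • ∫ p in Ioi (1 : ℝ) ×ˢ Ioc (0 : ℝ) (2 * π), f (((b : ℂ)) • (1 : Matrix (Fin 2) (Fin 2) ℂ) +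
          (((a : ℂ)) - (b : ℂ)) • !![(p.1 : ℂ), -(Real.sqrt (p.1 * (p.1 - 1)) : ℂ) * cexp (-(p.2 * I));
            (Real.sqrt (p.1 * (p.1 - 1)) : ℂ) * cexp (p.2 * I), 1 - p.1]))
    (f : Matrix (Fin 2) (Fin 2) ℂ → E) (hf : ContDiff ℝ 1 f) (hfc : HasCompactSupport f) (z : Circle) :
    Tendsto (fun ψ : ℝ => deriv (fun ψ : ℝ => (2 * Real.sin ψ) •
        ∫ h : S, f (((h * ⟨circleDiagonal 2 ![z * Circle.exp ψ, z * Circle.exp (-ψ)], hS _⟩ * h⁻¹ : S) :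
          GL (Fin 2) ℂ) : Matrix (Fin 2) (Fin 2) ℂ) ∂μ) ψ)
      (𝓝[≠] 0) (𝓝 ((-(2 * π) * C₁) • f ((z : ℂ) • (1 : Matrix (Fin 2) (Fin 2) ℂ)))) ∧
    ∀ ψ ∈ Ioo (-1 : ℝ) 1, ψ ≠ 0 → DifferentiableAt ℝ (fun ψ : ℝ => (2 * Real.sin ψ) •
        ∫ h : S, f (((h * ⟨circleDiagonal 2 ![z * Circle.exp ψ, z * Circle.exp (-ψ)], hS _⟩ * h⁻¹ : S) :
          GL (Fin 2) ℂ) : Matrix (Fin 2) (Fin 2) ℂ) ∂μ) ψ := by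
  -- the chart function of `ArchRankOneLimitFormula` (M4), as an opaque constant
  obtain ⟨g, hg⟩ : ∃ g : ℝ → E, g = fun ψ : ℝ => (2 * Real.sin ψ) •
        ∫ p in Ioi (1 : ℝ) ×ˢ Ioc (0 : ℝ) (2 * π),
          f (((z : ℂ) * cexp (-((ψ : ℂ) * I))) • (1 : Matrix (Fin 2) (Fin 2) ℂ) +
            ((z : ℂ) * cexp ((ψ : ℂ) * I) - (z : ℂ) * cexp (-((ψ : ℂ) * I))) •
              !![((p.1 : ℝ) : ℂ), -(Real.sqrt (p.1 * (p.1 - 1)) : ℂ) * cexp (-((p.2 : ℂ) * I));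
                 (Real.sqrt (p.1 * (p.1 - 1)) : ℂ) * cexp ((p.2 : ℂ) * I), 1 - ((p.1 : ℝ) : ℂ)]) := ⟨_, rfl⟩
  obtain ⟨F, hF⟩ : ∃ F : ℝ → E, F = fun ψ : ℝ => (2 * Real.sin ψ) •
        ∫ h : S, f (((h * ⟨circleDiagonal 2 ![z * Circle.exp ψ, z * Circle.exp (-ψ)], hS _⟩ * h⁻¹ : S) :
          GL (Fin 2) ℂ) : Matrix (Fin 2) (Fin 2) ℂ) ∂μ := ⟨_, rfl⟩
  rw [← hF]
  -- (M4) and the differentiability export, for `g`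
  have hM4 := tendsto_deriv_two_sin_smul_integral_chart f hf hfc z
  have hdg : ∀ {ψ : ℝ}, ψ ∈ Ioo (-1 : ℝ) 1 → ψ ≠ 0 → DifferentiableAt ℝ g ψ := fun hψ hψ0 => by
    rw [hg]; exact differentiableAt_two_sin_smul_integral_chart f hf hfc z hψ hψ0
  rw [← hg] at hM4
  -- the key identity `F ψ = C₁ • g ψ` on `|ψ| < 1`
  have key : ∀ ψ ∈ Ioo (-1 : ℝ) 1, F ψ = C₁ • g ψ := by
    intro ψ hψ
    rcases eq_or_ne ψ 0 with rfl | hψ0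
    · rw [hF, hg]; simp
    have hab : z * Circle.exp ψ ≠ z * Circle.exp (-ψ) := by
      intro h
      have h' := mul_left_cancel h
      rw [Circle.exp_eq_exp] at h'
      obtain ⟨m, hm⟩ := h'
      have hm' : (m : ℝ) * π = ψ := by linarith
      have habs : |(m : ℝ)| * π < 1 := by
        rw [← abs_of_pos Real.pi_pos, ← abs_mul, hm']; exact abs_lt.2 ⟨hψ.1, hψ.2⟩
      have hm0 : m = 0 := by
        by_contra hne
        have h1 : (1 : ℝ) ≤ |(m : ℝ)| := by exact_mod_cast Int.one_le_abs hne
        nlinarith [Real.pi_gt_three, abs_nonneg (m : ℝ)]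
      subst hm0
      simp at hm'
      exact hψ0 hm'.symm
    have h1 := hμ f hf.continuous hfc _ _ hab
    have h2 : ∀ h : S, (((h * ⟨circleDiagonal 2 ![z * Circle.exp ψ, z * Circle.exp (-ψ)], hS _⟩ * h⁻¹ : S) :
          GL (Fin 2) ℂ) : Matrix (Fin 2) (Fin 2) ℂ) =
        ((h : GL (Fin 2) ℂ) : Matrix (Fin 2) (Fin 2) ℂ) *
          Matrix.diagonal ![((z * Circle.exp ψ : Circle) : ℂ), ((z * Circle.exp (-ψ) : Circle) : ℂ)] *
          (((h⁻¹ : S) : GL (Fin 2) ℂ) : Matrix (Fin 2) (Fin 2) ℂ) := fun h => by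
      simp only [Subgroup.coe_mul, Units.val_mul, coe_circleDiagonal]
      congr 2
      funext i; fin_cases i <;> rfl
    have h3 : ((z * Circle.exp ψ : Circle) : ℂ) = (z : ℂ) * cexp ((ψ : ℂ) * I) := by
      rw [Circle.coe_mul, Circle.coe_exp]
    have h4 : ((z * Circle.exp (-ψ) : Circle) : ℂ) = (z : ℂ) * cexp (-((ψ : ℂ) * I)) := by
      rw [Circle.coe_mul, Circle.coe_exp]; push_cast; rw [neg_mul]
    rw [hF, hg]; dsimp only; simp_rw [h2]; rw [h1, smul_comm, h3, h4]
  have hev : ∀ ψ₀ ∈ Ioo (-1 : ℝ) 1, F =ᶠ[𝓝 ψ₀] fun ψ => C₁ • g ψ := fun ψ₀ h₀ => by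
    filter_upwards [isOpen_Ioo.mem_nhds h₀] with ψ hψ using key ψ hψ
  refine ⟨?_, fun ψ hψ hψ0 => (hev ψ hψ).differentiableAt_iff.2 ((hdg hψ hψ0).const_smul C₁)⟩
  have hlim : Tendsto (fun ψ => C₁ • deriv g ψ) (𝓝[≠] 0)
      (𝓝 (C₁ • ((-(2 * π)) • f ((z : ℂ) • (1 : Matrix (Fin 2) (Fin 2) ℂ))))) := hM4.const_smul C₁
  rw [show (-(2 * π) * C₁) • f ((z : ℂ) • (1 : Matrix (Fin 2) (Fin 2) ℂ)) =
      C₁ • ((-(2 * π)) • f ((z : ℂ) • (1 : Matrix (Fin 2) (Fin 2) ℂ))) by rw [smul_smul, mul_comm]]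
  refine hlim.congr' ?_
  have hmem : Ioo (-1 : ℝ) 1 ∩ {0}ᶜ ∈ 𝓝[≠] (0 : ℝ) :=
    inter_mem (mem_nhdsWithin_of_mem_nhds (Ioo_mem_nhds (by norm_num) (by norm_num))) self_mem_nhdsWithin
  filter_upwards [hmem] with ψ hψ
  rw [(hev ψ hψ.1).deriv_eq, deriv_fun_const_smul C₁ (hdg hψ.1 hψ.2)]

/-! ## §2 Transport of the limit formula along a torus-fixing conjugation `S′ ≃ₜ* S`, `h′ ↦ T h′ T⁻¹` -/

omit [CompleteSpace E] in
/-- The test function transported by `Ad(T⁻¹)`, `X ↦ f(T⁻¹ X T)`, is again `C¹` with compact support, and agrees with `f` at the central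
points `z • 1`. [folklore] -/
private theorem contDiff_hasCompactSupport_comp_conj (T : GL (Fin 2) ℂ) {f : Matrix (Fin 2) (Fin 2) ℂ → E}
    (hf : ContDiff ℝ 1 f) (hfc : HasCompactSupport f) :
    ContDiff ℝ 1 (fun X : Matrix (Fin 2) (Fin 2) ℂ =>
        f (((T⁻¹ : GL (Fin 2) ℂ) : Matrix (Fin 2) (Fin 2) ℂ) * X * (T : Matrix (Fin 2) (Fin 2) ℂ))) ∧
      HasCompactSupport (fun X : Matrix (Fin 2) (Fin 2) ℂ =>
        f (((T⁻¹ : GL (Fin 2) ℂ) : Matrix (Fin 2) (Fin 2) ℂ) * X * (T : Matrix (Fin 2) (Fin 2) ℂ))) := by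
  refine ⟨hf.comp ((contDiff_const.mul contDiff_id).mul contDiff_const), ?_⟩
  -- `X ↦ T⁻¹ X T` is a homeomorphism of `M₂(ℂ)` (inverse `X ↦ T X T⁻¹`)
  let φ : Matrix (Fin 2) (Fin 2) ℂ ≃ₜ Matrix (Fin 2) (Fin 2) ℂ :=
    { toFun := fun X => ((T⁻¹ : GL (Fin 2) ℂ) : Matrix (Fin 2) (Fin 2) ℂ) * X * (T : Matrix (Fin 2) (Fin 2) ℂ)
      invFun := fun X => (T : Matrix (Fin 2) (Fin 2) ℂ) * X * ((T⁻¹ : GL (Fin 2) ℂ) : Matrix (Fin 2) (Fin 2) ℂ)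
      left_inv := fun X => by
        simp only [← Matrix.mul_assoc, Units.mul_inv, Matrix.one_mul]
        rw [Matrix.mul_assoc, Units.mul_inv, Matrix.mul_one]
      right_inv := fun X => by
        simp only [← Matrix.mul_assoc, Units.inv_mul, Matrix.one_mul]
        rw [Matrix.mul_assoc, Units.inv_mul, Matrix.mul_one]
      continuous_toFun := (continuous_const.mul continuous_id).mul continuous_const
      continuous_invFun := (continuous_const.mul continuous_id).mul continuous_const }
  exact hfc.comp_homeomorph φ

omit [CompleteSpace E] in
/-- **Transport step.**  Let `S, S′ ≤ GL₂(ℂ)` both contain the circle torus and let `e : S′ ≃ₜ* S`, `h′ ↦ T h′ T⁻¹` be conjugation by a `T` commuting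
with the torus (e.g. the tree's `unitaryGroupOfFormCongrOfEq` along a diagonal `T`, or the identity map between two spellings of the same subgroup).
If the limit formula with differentiability holds on `S` for every Haar measure (constant `C ≠ 0` depending on the measure), it holds on `S′`:
the Haar measure is pushed forward along `e`, the test function is replaced by `X ↦ f(T⁻¹ X T)` (same value at `z • 1`), and
`h′·γ·h′⁻¹ ↦ T⁻¹ (h·γ·h⁻¹) T` because `T γ = γ T`. [cite: Varadarajan1989, §6.4 Thm 22; Rogawski1990, §8.2 p. 119] -/
theorem tendsto_deriv_orbitalIntegral_transport (S S' : Subgroup (GL (Fin 2) ℂ)) [MeasurableSpace S] [BorelSpace S]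
    [MeasurableSpace S'] [BorelSpace S'] (hS : ∀ w : Fin 2 → Circle, circleDiagonal 2 w ∈ S)
    (hS' : ∀ w : Fin 2 → Circle, circleDiagonal 2 w ∈ S') (e : S' ≃ₜ* S) (T : GL (Fin 2) ℂ)
    (he : ∀ h' : S', ((e h' : S) : GL (Fin 2) ℂ) = T * (h' : GL (Fin 2) ℂ) * T⁻¹)
    (hT : ∀ w : Fin 2 → Circle, T * circleDiagonal 2 w = circleDiagonal 2 w * T)
    (hL : ∀ (μ : Measure S) [μ.IsHaarMeasure], ∃ C : ℝ, C ≠ 0 ∧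
      ∀ (f : Matrix (Fin 2) (Fin 2) ℂ → E), ContDiff ℝ 1 f → HasCompactSupport f → ∀ z : Circle,
        Tendsto (fun ψ : ℝ => deriv (fun ψ : ℝ => (2 * Real.sin ψ) •
            ∫ h : S, f (((h * ⟨circleDiagonal 2 ![z * Circle.exp ψ, z * Circle.exp (-ψ)], hS _⟩ * h⁻¹ : S) :
              GL (Fin 2) ℂ) : Matrix (Fin 2) (Fin 2) ℂ) ∂μ) ψ)
          (𝓝[≠] 0) (𝓝 (C • f ((z : ℂ) • (1 : Matrix (Fin 2) (Fin 2) ℂ)))) ∧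
        ∀ ψ ∈ Ioo (-1 : ℝ) 1, ψ ≠ 0 → DifferentiableAt ℝ (fun ψ : ℝ => (2 * Real.sin ψ) •
            ∫ h : S, f (((h * ⟨circleDiagonal 2 ![z * Circle.exp ψ, z * Circle.exp (-ψ)], hS _⟩ * h⁻¹ : S) :
              GL (Fin 2) ℂ) : Matrix (Fin 2) (Fin 2) ℂ) ∂μ) ψ)
    (μ' : Measure S') [μ'.IsHaarMeasure] :
    ∃ C : ℝ, C ≠ 0 ∧
      ∀ (f : Matrix (Fin 2) (Fin 2) ℂ → E), ContDiff ℝ 1 f → HasCompactSupport f → ∀ z : Circle,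
        Tendsto (fun ψ : ℝ => deriv (fun ψ : ℝ => (2 * Real.sin ψ) •
            ∫ h : S', f (((h * ⟨circleDiagonal 2 ![z * Circle.exp ψ, z * Circle.exp (-ψ)], hS' _⟩ * h⁻¹ : S') :
              GL (Fin 2) ℂ) : Matrix (Fin 2) (Fin 2) ℂ) ∂μ') ψ)
          (𝓝[≠] 0) (𝓝 (C • f ((z : ℂ) • (1 : Matrix (Fin 2) (Fin 2) ℂ)))) ∧
        ∀ ψ ∈ Ioo (-1 : ℝ) 1, ψ ≠ 0 → DifferentiableAt ℝ (fun ψ : ℝ => (2 * Real.sin ψ) •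
            ∫ h : S', f (((h * ⟨circleDiagonal 2 ![z * Circle.exp ψ, z * Circle.exp (-ψ)], hS' _⟩ * h⁻¹ : S') :
              GL (Fin 2) ℂ) : Matrix (Fin 2) (Fin 2) ℂ) ∂μ') ψ := by
  -- push the Haar measure forward along `e`
  obtain ⟨C, hC, hLC⟩ := hL (μ'.map e)
  refine ⟨C, hC, fun f hf hfc z => ?_⟩
  obtain ⟨hfT, hfTc⟩ := contDiff_hasCompactSupport_comp_conj (E := E) T hf hfc
  obtain ⟨hlim, hdiff⟩ := hLC _ hfT hfTc z
  -- `e.symm` on underlying elements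
  have hesymm : ∀ h : S, (((e.symm h : S') : GL (Fin 2) ℂ)) = T⁻¹ * (h : GL (Fin 2) ℂ) * T := fun h => by
    have h1 := he (e.symm h)
    rw [e.apply_symm_apply] at h1
    rw [h1]; group
  -- the integrals agree for every `ψ`
  have key : (fun ψ : ℝ => (2 * Real.sin ψ) •
      ∫ h : S', f (((h * ⟨circleDiagonal 2 ![z * Circle.exp ψ, z * Circle.exp (-ψ)], hS' _⟩ * h⁻¹ : S') :
        GL (Fin 2) ℂ) : Matrix (Fin 2) (Fin 2) ℂ) ∂μ') =
      fun ψ : ℝ => (2 * Real.sin ψ) •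
        ∫ h : S, (fun X : Matrix (Fin 2) (Fin 2) ℂ =>
            f (((T⁻¹ : GL (Fin 2) ℂ) : Matrix (Fin 2) (Fin 2) ℂ) * X * (T : Matrix (Fin 2) (Fin 2) ℂ)))
          (((h * ⟨circleDiagonal 2 ![z * Circle.exp ψ, z * Circle.exp (-ψ)], hS _⟩ * h⁻¹ : S) :
            GL (Fin 2) ℂ) : Matrix (Fin 2) (Fin 2) ℂ) ∂(μ'.map e) := by
    funext ψ
    congr 1
    rw [show (Measure.map (⇑e) μ' : Measure S) = Measure.map (⇑e.toHomeomorph.toMeasurableEquiv) μ' from rfl,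
      integral_map_equiv]
    refine integral_congr_ae (Eventually.of_forall fun h' => ?_)
    -- the measurable equivalence IS `e` (definitionally); restate the goal through `e h'`
    change f _ = f (((T⁻¹ : GL (Fin 2) ℂ) : Matrix (Fin 2) (Fin 2) ℂ) *
      (((e h' * ⟨circleDiagonal 2 ![z * Circle.exp ψ, z * Circle.exp (-ψ)], hS _⟩ * (e h')⁻¹ : S) :
        GL (Fin 2) ℂ) : Matrix (Fin 2) (Fin 2) ℂ) * (T : Matrix (Fin 2) (Fin 2) ℂ))
    -- conjugation bookkeeping in `GL₂(ℂ)`: `T γ = γ T`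
    have hc : T⁻¹ * circleDiagonal 2 ![z * Circle.exp ψ, z * Circle.exp (-ψ)] * T =
        circleDiagonal 2 ![z * Circle.exp ψ, z * Circle.exp (-ψ)] := by
      rw [mul_assoc, ← hT, ← mul_assoc, inv_mul_cancel, one_mul]
    have hGL : T⁻¹ * (((e h' * ⟨circleDiagonal 2 ![z * Circle.exp ψ, z * Circle.exp (-ψ)], hS _⟩ * (e h')⁻¹ : S) :
        GL (Fin 2) ℂ)) * T =
        ((h' * ⟨circleDiagonal 2 ![z * Circle.exp ψ, z * Circle.exp (-ψ)], hS' _⟩ * h'⁻¹ : S') : GL (Fin 2) ℂ) := by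
      simp only [Subgroup.coe_mul, Subgroup.coe_inv, he]
      calc T⁻¹ * (T * (h' : GL (Fin 2) ℂ) * T⁻¹ * circleDiagonal 2 ![z * Circle.exp ψ, z * Circle.exp (-ψ)] *
            (T * (h' : GL (Fin 2) ℂ) * T⁻¹)⁻¹) * T
          = (h' : GL (Fin 2) ℂ) * (T⁻¹ * circleDiagonal 2 ![z * Circle.exp ψ, z * Circle.exp (-ψ)] * T) *
              (h' : GL (Fin 2) ℂ)⁻¹ := by group
        _ = (h' : GL (Fin 2) ℂ) * circleDiagonal 2 ![z * Circle.exp ψ, z * Circle.exp (-ψ)] *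
              (h' : GL (Fin 2) ℂ)⁻¹ := by rw [hc]
    rw [← hGL, Units.val_mul, Units.val_mul]
  rw [key]
  exact ⟨by simpa using hlim, hdiff⟩

/-! ## §3 The unitary groups `U(diag(e₀, e₁))`, `e₀e₁ < 0`: congruence to the standard form and the final statement -/

/-- The circle torus lies in every diagonal unitary group `U(σ, (diag a).map σ)`. [folklore] -/
private theorem circleDiagonal_mem_unitaryGroupOfForm_diagonal_map {L : Type*} [CommRing L] (σ : L →+* ℂ)
    (a : Fin 2 → L) (w : Fin 2 → Circle) :
    circleDiagonal 2 w ∈ unitaryGroupOfForm (starRingEnd ℂ) ((Matrix.diagonal a).map σ) := by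
  rw [Matrix.diagonal_map (map_zero σ)]
  exact circleDiagonal_mem_unitaryGroupOfForm_diagonal 2 w _

/-- `U(σ, −H) = U(σ, H)`. [folklore] -/
private theorem unitaryGroupOfForm_neg_eq (H : Matrix (Fin 2) (Fin 2) ℂ) :
    unitaryGroupOfForm (starRingEnd ℂ) (-H) = unitaryGroupOfForm (starRingEnd ℂ) H := by
  ext g; rw [mem_unitaryGroupOfForm_iff, mem_unitaryGroupOfForm_iff, Matrix.mul_neg, Matrix.neg_mul, neg_inj]

/-- A diagonal `T ∈ GL₂(ℂ)` commutes with the circle torus. [folklore] -/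
private theorem diagonal_mul_circleDiagonal_comm (T : GL (Fin 2) ℂ) (d : Fin 2 → ℂ)
    (hTd : (T : Matrix (Fin 2) (Fin 2) ℂ) = Matrix.diagonal d) (w : Fin 2 → Circle) :
    T * circleDiagonal 2 w = circleDiagonal 2 w * T := by
  apply Units.ext; simp only [Units.val_mul, coe_circleDiagonal, hTd, Matrix.diagonal_mul_diagonal]; congr 1; funext i; ring

omit [CompleteSpace E] in
/-- **Congruence step.**  If `σ(T)ᵀ J T = H` for a DIAGONAL `T ∈ GL₂(ℂ)` and the limit formula (with differentiability) holds on `U(J)`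
for every Borel structure and every Haar measure, then it holds on `U(H)` with the same kind of constant (★ `unitaryGroupOfFormCongrOfEq`,
`h′ ↦ T h′ T⁻¹`, + `tendsto_deriv_orbitalIntegral_transport`). [cite: Varadarajan1989, §6.4 Thm 22; Rogawski1990, §8.2 p. 119] -/
theorem tendsto_deriv_orbitalIntegral_of_formCongr (J H : Matrix (Fin 2) (Fin 2) ℂ) (T : GL (Fin 2) ℂ) (d : Fin 2 → ℂ)
    (hTd : (T : Matrix (Fin 2) (Fin 2) ℂ) = Matrix.diagonal d) (hTJ : formCongr (starRingEnd ℂ) T J = H)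
    (hSJ : ∀ w : Fin 2 → Circle, circleDiagonal 2 w ∈ unitaryGroupOfForm (starRingEnd ℂ) J)
    (hSH : ∀ w : Fin 2 → Circle, circleDiagonal 2 w ∈ unitaryGroupOfForm (starRingEnd ℂ) H)
    (hL : ∀ [MeasurableSpace ↥(unitaryGroupOfForm (starRingEnd ℂ) J)] [BorelSpace ↥(unitaryGroupOfForm (starRingEnd ℂ) J)] (μ : Measure ↥(unitaryGroupOfForm (starRingEnd ℂ) J)) [μ.IsHaarMeasure], ∃ C : ℝ, C ≠ 0 ∧
      ∀ (f : Matrix (Fin 2) (Fin 2) ℂ → E), ContDiff ℝ 1 f → HasCompactSupport f → ∀ z : Circle,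
        Tendsto (fun ψ : ℝ => deriv (fun ψ : ℝ => (2 * Real.sin ψ) •
            ∫ h : ↥(unitaryGroupOfForm (starRingEnd ℂ) J), f (((h * ⟨circleDiagonal 2 ![z * Circle.exp ψ, z * Circle.exp (-ψ)], hSJ _⟩ * h⁻¹ : ↥(unitaryGroupOfForm (starRingEnd ℂ) J)) :
              GL (Fin 2) ℂ) : Matrix (Fin 2) (Fin 2) ℂ) ∂μ) ψ)
          (𝓝[≠] 0) (𝓝 (C • f ((z : ℂ) • (1 : Matrix (Fin 2) (Fin 2) ℂ)))) ∧
        ∀ ψ ∈ Ioo (-1 : ℝ) 1, ψ ≠ 0 → DifferentiableAt ℝ (fun ψ : ℝ => (2 * Real.sin ψ) •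
            ∫ h : ↥(unitaryGroupOfForm (starRingEnd ℂ) J), f (((h * ⟨circleDiagonal 2 ![z * Circle.exp ψ, z * Circle.exp (-ψ)], hSJ _⟩ * h⁻¹ : ↥(unitaryGroupOfForm (starRingEnd ℂ) J)) :
              GL (Fin 2) ℂ) : Matrix (Fin 2) (Fin 2) ℂ) ∂μ) ψ)
    [MeasurableSpace ↥(unitaryGroupOfForm (starRingEnd ℂ) H)] [BorelSpace ↥(unitaryGroupOfForm (starRingEnd ℂ) H)] (μ' : Measure ↥(unitaryGroupOfForm (starRingEnd ℂ) H)) [μ'.IsHaarMeasure] :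
    ∃ C : ℝ, C ≠ 0 ∧
      ∀ (f : Matrix (Fin 2) (Fin 2) ℂ → E), ContDiff ℝ 1 f → HasCompactSupport f → ∀ z : Circle,
        Tendsto (fun ψ : ℝ => deriv (fun ψ : ℝ => (2 * Real.sin ψ) •
            ∫ h : ↥(unitaryGroupOfForm (starRingEnd ℂ) H), f (((h * ⟨circleDiagonal 2 ![z * Circle.exp ψ, z * Circle.exp (-ψ)], hSH _⟩ * h⁻¹ : ↥(unitaryGroupOfForm (starRingEnd ℂ) H)) :
              GL (Fin 2) ℂ) : Matrix (Fin 2) (Fin 2) ℂ) ∂μ') ψ)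
          (𝓝[≠] 0) (𝓝 (C • f ((z : ℂ) • (1 : Matrix (Fin 2) (Fin 2) ℂ)))) ∧
        ∀ ψ ∈ Ioo (-1 : ℝ) 1, ψ ≠ 0 → DifferentiableAt ℝ (fun ψ : ℝ => (2 * Real.sin ψ) •
            ∫ h : ↥(unitaryGroupOfForm (starRingEnd ℂ) H), f (((h * ⟨circleDiagonal 2 ![z * Circle.exp ψ, z * Circle.exp (-ψ)], hSH _⟩ * h⁻¹ : ↥(unitaryGroupOfForm (starRingEnd ℂ) H)) :
              GL (Fin 2) ℂ) : Matrix (Fin 2) (Fin 2) ℂ) ∂μ') ψ := by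
  letI : MeasurableSpace ↥(unitaryGroupOfForm (starRingEnd ℂ) J) := borel _
  haveI : BorelSpace ↥(unitaryGroupOfForm (starRingEnd ℂ) J) := ⟨rfl⟩
  exact tendsto_deriv_orbitalIntegral_transport (E := E) (unitaryGroupOfForm (starRingEnd ℂ) J) (unitaryGroupOfForm (starRingEnd ℂ) H) hSJ hSH
    (unitaryGroupOfFormCongrOfEq (starRingEnd ℂ) T J H hTJ) T (fun _ => rfl) (diagonal_mul_circleDiagonal_comm T d hTd)
    (fun μ _ => hL μ) μ'

/-- **(R1G) HARISH-CHANDRA'S LIMIT FORMULA ON THE GROUP `U(e₀, e₁)`, `e₀e₁ < 0` (general weights).**  Let `σ : L → ℂ`, `a : Fin 2 → L` with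
`σ(a₀), σ(a₁)` real of opposite signs, `G₂ = U(σ, diag(σ a)) ≅ U(1,1)`, `μ₂` ANY Haar measure on `G₂`.  ASSUME the orbit-chart identity (HB) on
the standard group `U(diag(1,−1))` (F0P3a-p07's `ArchRankOneOrbitChart`, taken here as the hypothesis `hHB`).  THEN there is ONE constant `C ≠ 0`
(depending on `μ₂` only) such that for every `f ∈ C¹_c(M₂(ℂ), E)` and every `z ∈ S¹`:
`lim_{ψ → 0, ψ ≠ 0} ∂_ψ [2 sin ψ · ∫_{G₂} f(h · diag(z e^{iψ}, z e^{−iψ}) · h⁻¹) dμ₂(h)] = C • f(z·1)`, and the normalised orbital integral is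
differentiable for `0 < |ψ| < 1`.  Road: (HB) + ★ (M4) `tendsto_deriv_two_sin_smul_integral_chart` on `U(diag(1,−1))` (`C = −2π·C₁`), then the
diagonal congruence `T = diag(√|e₀|, √|e₁|)` (`σ(T)ᵀ (±diag(1,−1)) T = diag(e₀,e₁)`, `U(−J) = U(J)`) transports Haar measure, test function and
torus point.  Consumed by F0P3a-p06's (γ) Bruhat-cutoff descent `archLimitFormulaNoncompactWall_holds`.
[cite: Varadarajan1989, §6.4 Thm 22; Rogawski1990, §8.2 p. 119] -/
theorem exists_tendsto_deriv_two_sin_smul_orbitalIntegral_of_chart_identity {L : Type*} [CommRing L] (σ : L →+* ℂ)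
    (a : Fin 2 → L) (hreal : ∀ i, (σ (a i)).im = 0) (hsgn : (σ (a 0)).re * (σ (a 1)).re < 0)
    (hHB : ∀ [MeasurableSpace ↥(unitaryGroupOfForm (starRingEnd ℂ) (Matrix.diagonal ![(1 : ℂ), -1]))] [BorelSpace ↥(unitaryGroupOfForm (starRingEnd ℂ) (Matrix.diagonal ![(1 : ℂ), -1]))] (μ : Measure ↥(unitaryGroupOfForm (starRingEnd ℂ) (Matrix.diagonal ![(1 : ℂ), -1]))) [μ.IsHaarMeasure],
      ∃ C₁ : ℝ, 0 < C₁ ∧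
        ∀ (f : Matrix (Fin 2) (Fin 2) ℂ → E), Continuous f → HasCompactSupport f → ∀ a b : Circle, a ≠ b →
          ∫ h : ↥(unitaryGroupOfForm (starRingEnd ℂ) (Matrix.diagonal ![(1 : ℂ), -1])), f (((h : GL (Fin 2) ℂ) : Matrix (Fin 2) (Fin 2) ℂ) *
              Matrix.diagonal ![(a : ℂ), (b : ℂ)] * (((h⁻¹ : ↥(unitaryGroupOfForm (starRingEnd ℂ) (Matrix.diagonal ![(1 : ℂ), -1]))) : GL (Fin 2) ℂ) : Matrix (Fin 2) (Fin 2) ℂ)) ∂μ =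
            C₁ • ∫ p in Ioi (1 : ℝ) ×ˢ Ioc (0 : ℝ) (2 * π), f (((b : ℂ)) • (1 : Matrix (Fin 2) (Fin 2) ℂ) +
              (((a : ℂ)) - (b : ℂ)) • !![(p.1 : ℂ), -(Real.sqrt (p.1 * (p.1 - 1)) : ℂ) * cexp (-(p.2 * I));
                (Real.sqrt (p.1 * (p.1 - 1)) : ℂ) * cexp (p.2 * I), 1 - p.1]))
    [MeasurableSpace ↥(unitaryGroupOfForm (starRingEnd ℂ) ((Matrix.diagonal a).map σ))] [BorelSpace ↥(unitaryGroupOfForm (starRingEnd ℂ) ((Matrix.diagonal a).map σ))] (μ₂ : Measure ↥(unitaryGroupOfForm (starRingEnd ℂ) ((Matrix.diagonal a).map σ))) [μ₂.IsHaarMeasure] :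
    ∃ C : ℝ, C ≠ 0 ∧
      ∀ (f : Matrix (Fin 2) (Fin 2) ℂ → E), ContDiff ℝ 1 f → HasCompactSupport f → ∀ z : Circle,
        Tendsto (fun ψ : ℝ => deriv (fun ψ : ℝ => (2 * Real.sin ψ) •
            ∫ h : ↥(unitaryGroupOfForm (starRingEnd ℂ) ((Matrix.diagonal a).map σ)), f (((h * ⟨circleDiagonal 2 ![z * Circle.exp ψ, z * Circle.exp (-ψ)], circleDiagonal_mem_unitaryGroupOfForm_diagonal_map σ a _⟩ * h⁻¹ : ↥(unitaryGroupOfForm (starRingEnd ℂ) ((Matrix.diagonal a).map σ))) :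
              GL (Fin 2) ℂ) : Matrix (Fin 2) (Fin 2) ℂ) ∂μ₂) ψ)
          (𝓝[≠] 0) (𝓝 (C • f ((z : ℂ) • (1 : Matrix (Fin 2) (Fin 2) ℂ)))) ∧
        ∀ ψ ∈ Ioo (-1 : ℝ) 1, ψ ≠ 0 → DifferentiableAt ℝ (fun ψ : ℝ => (2 * Real.sin ψ) •
            ∫ h : ↥(unitaryGroupOfForm (starRingEnd ℂ) ((Matrix.diagonal a).map σ)), f (((h * ⟨circleDiagonal 2 ![z * Circle.exp ψ, z * Circle.exp (-ψ)], circleDiagonal_mem_unitaryGroupOfForm_diagonal_map σ a _⟩ * h⁻¹ : ↥(unitaryGroupOfForm (starRingEnd ℂ) ((Matrix.diagonal a).map σ))) :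
              GL (Fin 2) ℂ) : Matrix (Fin 2) (Fin 2) ℂ) ∂μ₂) ψ := by
  -- the target form `H = diag(e₀, e₁)` with real entries
  set e₀ : ℝ := (σ (a 0)).re with he₀
  set e₁ : ℝ := (σ (a 1)).re with he₁
  have hH : (Matrix.diagonal a).map σ = Matrix.diagonal ![(e₀ : ℂ), (e₁ : ℂ)] := by
    rw [Matrix.diagonal_map (map_zero σ)]
    congr 1; funext i
    fin_cases i
    · exact Complex.ext (by simp [he₀]) (by simp [hreal 0])
    · exact Complex.ext (by simp [he₁]) (by simp [hreal 1])
  -- Step 1: the limit formula on a standard group `U(J)` from (HB), for `J = ±diag(1,−1)`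
  have hstd : ∀ (J : Matrix (Fin 2) (Fin 2) ℂ), unitaryGroupOfForm (starRingEnd ℂ) J =
      unitaryGroupOfForm (starRingEnd ℂ) (Matrix.diagonal ![(1 : ℂ), -1]) →
      ∀ (hSJ : ∀ w : Fin 2 → Circle, circleDiagonal 2 w ∈ unitaryGroupOfForm (starRingEnd ℂ) J),
      ∀ [MeasurableSpace ↥(unitaryGroupOfForm (starRingEnd ℂ) J)] [BorelSpace ↥(unitaryGroupOfForm (starRingEnd ℂ) J)] (μ : Measure ↥(unitaryGroupOfForm (starRingEnd ℂ) J)) [μ.IsHaarMeasure], ∃ C : ℝ, C ≠ 0 ∧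
      ∀ (f : Matrix (Fin 2) (Fin 2) ℂ → E), ContDiff ℝ 1 f → HasCompactSupport f → ∀ z : Circle,
        Tendsto (fun ψ : ℝ => deriv (fun ψ : ℝ => (2 * Real.sin ψ) •
            ∫ h : ↥(unitaryGroupOfForm (starRingEnd ℂ) J), f (((h * ⟨circleDiagonal 2 ![z * Circle.exp ψ, z * Circle.exp (-ψ)], hSJ _⟩ * h⁻¹ : ↥(unitaryGroupOfForm (starRingEnd ℂ) J)) :
              GL (Fin 2) ℂ) : Matrix (Fin 2) (Fin 2) ℂ) ∂μ) ψ)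
          (𝓝[≠] 0) (𝓝 (C • f ((z : ℂ) • (1 : Matrix (Fin 2) (Fin 2) ℂ)))) ∧
        ∀ ψ ∈ Ioo (-1 : ℝ) 1, ψ ≠ 0 → DifferentiableAt ℝ (fun ψ : ℝ => (2 * Real.sin ψ) •
            ∫ h : ↥(unitaryGroupOfForm (starRingEnd ℂ) J), f (((h * ⟨circleDiagonal 2 ![z * Circle.exp ψ, z * Circle.exp (-ψ)], hSJ _⟩ * h⁻¹ : ↥(unitaryGroupOfForm (starRingEnd ℂ) J)) :
              GL (Fin 2) ℂ) : Matrix (Fin 2) (Fin 2) ℂ) ∂μ) ψ := by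
    intro J hJ
    rw [hJ]
    intro hSJ _ _ μ _
    obtain ⟨C₁, hC₁, hμ⟩ := hHB μ
    refine ⟨-(2 * π) * C₁, mul_ne_zero (neg_ne_zero.2 (by positivity)) hC₁.ne', fun f hf hfc z => ?_⟩
    exact tendsto_deriv_two_sin_smul_integral_conj_of_chart_identity _ μ hSJ C₁ hμ f hf hfc z
  -- Step 2: the sign of `e₀` decides which standard form is congruent to `H`
  have he₀0 : e₀ ≠ 0 := fun h => by rw [h, zero_mul] at hsgn; exact lt_irrefl _ hsgn
  rcases lt_or_gt_of_ne he₀0 with hneg | hpos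
  · -- `e₀ < 0 < e₁`: `J = diag(−1, 1) = −diag(1,−1)`, `T = diag(√(−e₀), √e₁)`
    have he₁ : 0 < e₁ := by nlinarith
    have hJ : unitaryGroupOfForm (starRingEnd ℂ) (Matrix.diagonal ![(-1 : ℂ), 1]) =
        unitaryGroupOfForm (starRingEnd ℂ) (Matrix.diagonal ![(1 : ℂ), -1]) := by
      rw [← unitaryGroupOfForm_neg_eq]; congr 1; ext i j; fin_cases i <;> fin_cases j <;> simp
    have hdet : (Matrix.diagonal ![((Real.sqrt (-e₀) : ℝ) : ℂ), ((Real.sqrt e₁ : ℝ) : ℂ)]).det ≠ 0 := by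
      rw [Matrix.det_diagonal, Fin.prod_univ_two]
      simp only [Matrix.cons_val_zero, Matrix.cons_val_one]
      exact mul_ne_zero (by exact_mod_cast (Real.sqrt_pos.2 (by linarith)).ne')
        (by exact_mod_cast (Real.sqrt_pos.2 he₁).ne')
    obtain ⟨T, hT⟩ : ∃ T : GL (Fin 2) ℂ, (T : Matrix (Fin 2) (Fin 2) ℂ) =
        Matrix.diagonal ![((Real.sqrt (-e₀) : ℝ) : ℂ), ((Real.sqrt e₁ : ℝ) : ℂ)] :=
      ⟨Matrix.GeneralLinearGroup.mkOfDetNeZero _ hdet, rfl⟩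
    have hTJ : formCongr (starRingEnd ℂ) T (Matrix.diagonal ![(-1 : ℂ), 1]) = (Matrix.diagonal a).map σ := by
      rw [hH, formCongr, hT]
      have h0 : ((Real.sqrt (-e₀) : ℝ) : ℂ) * ((Real.sqrt (-e₀) : ℝ) : ℂ) = -(e₀ : ℂ) := by
        rw [← Complex.ofReal_mul, Real.mul_self_sqrt (by linarith)]; push_cast; ring
      have h1 : ((Real.sqrt e₁ : ℝ) : ℂ) * ((Real.sqrt e₁ : ℝ) : ℂ) = (e₁ : ℂ) := by
        rw [← Complex.ofReal_mul, Real.mul_self_sqrt he₁.le]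
      ext i j
      fin_cases i <;> fin_cases j <;>
        simp [Matrix.diagonal_map, Matrix.diagonal_transpose, Matrix.diagonal_mul_diagonal, Complex.conj_ofReal, h0, h1]
    exact tendsto_deriv_orbitalIntegral_of_formCongr (E := E) _ _ T _ hT hTJ (fun w => circleDiagonal_mem_unitaryGroupOfForm_diagonal 2 w _)
      (circleDiagonal_mem_unitaryGroupOfForm_diagonal_map σ a)
      (hstd _ hJ fun w => circleDiagonal_mem_unitaryGroupOfForm_diagonal 2 w _) μ₂
  · -- `e₀ > 0 > e₁`: `J = diag(1,−1)`, `T = diag(√e₀, √(−e₁))`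
    have he₁ : e₁ < 0 := by nlinarith
    have hdet : (Matrix.diagonal ![((Real.sqrt e₀ : ℝ) : ℂ), ((Real.sqrt (-e₁) : ℝ) : ℂ)]).det ≠ 0 := by
      rw [Matrix.det_diagonal, Fin.prod_univ_two]
      simp only [Matrix.cons_val_zero, Matrix.cons_val_one]
      exact mul_ne_zero (by exact_mod_cast (Real.sqrt_pos.2 hpos).ne')
        (by exact_mod_cast (Real.sqrt_pos.2 (by linarith)).ne')
    obtain ⟨T, hT⟩ : ∃ T : GL (Fin 2) ℂ, (T : Matrix (Fin 2) (Fin 2) ℂ) =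
        Matrix.diagonal ![((Real.sqrt e₀ : ℝ) : ℂ), ((Real.sqrt (-e₁) : ℝ) : ℂ)] :=
      ⟨Matrix.GeneralLinearGroup.mkOfDetNeZero _ hdet, rfl⟩
    have hTJ : formCongr (starRingEnd ℂ) T (Matrix.diagonal ![(1 : ℂ), -1]) = (Matrix.diagonal a).map σ := by
      rw [hH, formCongr, hT]
      have h0 : ((Real.sqrt e₀ : ℝ) : ℂ) * ((Real.sqrt e₀ : ℝ) : ℂ) = (e₀ : ℂ) := by
        rw [← Complex.ofReal_mul, Real.mul_self_sqrt hpos.le]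
      have h1 : ((Real.sqrt (-e₁) : ℝ) : ℂ) * ((Real.sqrt (-e₁) : ℝ) : ℂ) = -(e₁ : ℂ) := by
        rw [← Complex.ofReal_mul, Real.mul_self_sqrt (by linarith)]; push_cast; ring
      ext i j
      fin_cases i <;> fin_cases j <;>
        simp [Matrix.diagonal_map, Matrix.diagonal_transpose, Matrix.diagonal_mul_diagonal, Complex.conj_ofReal, h0, h1]
    exact tendsto_deriv_orbitalIntegral_of_formCongr (E := E) _ _ T _ hT hTJ (fun w => circleDiagonal_mem_unitaryGroupOfForm_diagonal 2 w _)
      (circleDiagonal_mem_unitaryGroupOfForm_diagonal_map σ a)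
      (hstd _ rfl fun w => circleDiagonal_mem_unitaryGroupOfForm_diagonal 2 w _) μ₂

/-! ## §4 (ED. 2) The hypothesis-free statement, over F0P3a-p07's orbit-chart identity ★ `ArchRankOneOrbitChart` -/
/-- **(R1G) HARISH-CHANDRA'S LIMIT FORMULA ON THE GROUP `U(e₀,e₁)`, `e₀e₁ < 0` — HYPOTHESIS-FREE (ED. 2)**: `∃ C ≠ 0` (depending on the Haar measure `μ₂` only) with
`∂_ψ [2 sin ψ · ∫_{G₂} f(h·diag(z e^{iψ}, z e^{−iψ})·h⁻¹) dμ₂] → C • f(z•1)` (`ψ → 0`, `ψ ≠ 0`) and differentiability for `0 < |ψ| < 1`, for all `f ∈ C¹_c(M₂(ℂ), E)`, `z ∈ S¹`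
(= `…_of_chart_identity` with (HB) := ★ `exists_integral_comp_conj_diag_eq_smul_integral_chart`, F0P3a-p07 p840627 — stronger than needed: all `a b : ℂ`, no support condition).
Consumed BY NAME by F0P3a-p06's `archLimitFormulaNoncompactWall_holds`. [cite: Varadarajan1989, §6.4 Thm 22; Rogawski1990, §8.2 p. 119] -/
theorem exists_tendsto_deriv_two_sin_smul_orbitalIntegral {L : Type*} [CommRing L] (σ : L →+* ℂ) (a : Fin 2 → L)
    (hreal : ∀ i, (σ (a i)).im = 0) (hsgn : (σ (a 0)).re * (σ (a 1)).re < 0)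
    [MeasurableSpace ↥(unitaryGroupOfForm (starRingEnd ℂ) ((Matrix.diagonal a).map σ))] [BorelSpace ↥(unitaryGroupOfForm (starRingEnd ℂ) ((Matrix.diagonal a).map σ))] (μ₂ : Measure ↥(unitaryGroupOfForm (starRingEnd ℂ) ((Matrix.diagonal a).map σ))) [μ₂.IsHaarMeasure] :
    ∃ C : ℝ, C ≠ 0 ∧
      ∀ (f : Matrix (Fin 2) (Fin 2) ℂ → E), ContDiff ℝ 1 f → HasCompactSupport f → ∀ z : Circle,
        Tendsto (fun ψ : ℝ => deriv (fun ψ : ℝ => (2 * Real.sin ψ) •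
            ∫ h : ↥(unitaryGroupOfForm (starRingEnd ℂ) ((Matrix.diagonal a).map σ)), f (((h * ⟨circleDiagonal 2 ![z * Circle.exp ψ, z * Circle.exp (-ψ)], circleDiagonal_mem_unitaryGroupOfForm_diagonal_map σ a _⟩ * h⁻¹ : ↥(unitaryGroupOfForm (starRingEnd ℂ) ((Matrix.diagonal a).map σ))) :
              GL (Fin 2) ℂ) : Matrix (Fin 2) (Fin 2) ℂ) ∂μ₂) ψ)
          (𝓝[≠] 0) (𝓝 (C • f ((z : ℂ) • (1 : Matrix (Fin 2) (Fin 2) ℂ)))) ∧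
        ∀ ψ ∈ Ioo (-1 : ℝ) 1, ψ ≠ 0 → DifferentiableAt ℝ (fun ψ : ℝ => (2 * Real.sin ψ) •
            ∫ h : ↥(unitaryGroupOfForm (starRingEnd ℂ) ((Matrix.diagonal a).map σ)), f (((h * ⟨circleDiagonal 2 ![z * Circle.exp ψ, z * Circle.exp (-ψ)], circleDiagonal_mem_unitaryGroupOfForm_diagonal_map σ a _⟩ * h⁻¹ : ↥(unitaryGroupOfForm (starRingEnd ℂ) ((Matrix.diagonal a).map σ))) :
              GL (Fin 2) ℂ) : Matrix (Fin 2) (Fin 2) ℂ) ∂μ₂) ψ :=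
  exists_tendsto_deriv_two_sin_smul_orbitalIntegral_of_chart_identity σ a hreal hsgn
    (fun μ _ => by
      obtain ⟨C₁, hC₁, h⟩ := exists_integral_comp_conj_diag_eq_smul_integral_chart (E := E) μ
      exact ⟨C₁, hC₁, fun f hf _ a b _ => h f hf a b⟩) μ₂

end Literature.NumberTheory.Automorphic.UnitaryGroup
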